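import Mathlib
import HarnessLib
import Summits.Ventures.LatticeQCDFlow.Scaling.WorkExponentialMoments
import Summits.Ventures.LatticeQCDFlow.Scaling.StochasticBudgets
import Summits.Ventures.LatticeQCDFlow.Scaling.AcceptanceEssEightNinths
import Summits.Ventures.LatticeQCDFlow.Scaling.GeneralLayerESSFloor

/-!
# GeneralLayerESSFloorSharp — the ESS floor for arbitrary relaxation layers in its `2τ̄` form:
# `ÊSS ≥ exp(−((1+θ₂)/(1−θ₂))·σ̄²/n)`, `θ₂ = ρ·e^{3ΔD/n}` (the `t = 2` exponential moment)

HONEST FRAMING: exact (Metropolis-corrected) sampling algorithms for lattice gauge theory;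
figures of merit are autocorrelation/cost numbers at stated couplings and volumes; no
continuum-physics claim.

Venture `LatticeQCDFlow` (cell pub-lqcd), topic `Scaling`; FANOUT row 19 (`su2-snf`, GEN-6).
OUR WORK, nothing cited as a fact.  `Scaling/GeneralLayerESSFloor` (this seat) proves
`ÊSS ≥ exp(−(e^{ΔD/n} + 2θ₂/(1−θ₂))σ̄²/n)` through the `χ²` bound on the perfect-relaxation factors;
the work-MGF envelope `Scaling/WorkExponentialMoments` at `t = 2` controls the same second moment
with the calculus bound of `Scaling/LinearFamilyStepMGF` on the perfect part (`Λ(2) ≤ δ²σ̄²`, no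
`e^{ΔD/n}`), which gives the floor EXACTLY in the shape of E7's law `−log ESS = 2τ_int·σ²Δ²·n_dof/n_step`
(`Scaling/AR1SwitchingLaw`: `2τ̄(θ) = (1+θ)/(1−θ)`):

* `inv_essFrac_path_eq_expMoment_two` — `1/ÊSS = E_F[e^{−2(W − ΔF)}]` (the uniform-grid
  instance of `Scaling/PathWorkMoments.inv_essFrac_path_eq_sum_exp_two`);
* **`exp_le_ess_path_uniform_sharp`** — for positive layers with unit row sums leaving the
  Boltzmann weights invariant and `χ²`-contracting towards their targets with `ρ ≥ 0`,
  `|D x − D y| ≤ ΔD`, `Var_c(D) ≤ σ̄²` (all `c`), `θ₂ = ρe^{3ΔD/n} < 1`: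
  `exp(−((1+θ₂)/(1−θ₂))·σ̄²/n) ≤ ÊSS`, i.e. **`−log ÊSS ≤ 2τ̄(θ₂)·σ̄²/n`**;
  `exp_le_ess_path_uniform_sharp_of_reversible` — the instance `ρ = max_k λ⋆(P_k)`;
* **`accRate_path_uniform_ge`** — with theory-2's `accRate ≥ (8/9)·ESS`
  (`AcceptanceEssEightNinths.accRate_mul_inv_essFrac_ge`): the stationary Metropolis acceptance of
  the non-equilibrium path proposal (NCMC / SNF Metropolis step, `Exactness.accRate` on path space)
  obeys `(8/9)·exp(−((1+θ₂)/(1−θ₂))σ̄²/n) ≤ acc` for every such layer family;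
* `exp_le_ess_path_uniform_rational` — an `exp`-free reading for `n > 3ΔD + ρn` (i.e.
  `u = 3ΔD/n < 1 − ρ`): `exp(−((1−u+ρ)/(1−u−ρ))·σ̄²/n) ≤ ÊSS` (Mathlib's `e^{u} ≤ 1/(1−u)`), whose
  constant tends to `(1+ρ)/(1−ρ) = 2τ̄(ρ)` as `n → ∞`;
* **`ess_ge_one_sub_of_steps`** — HOW MANY STEPS FOR `ÊSS ≥ 1 − ε` WITH ANY SUCH LAYERS:
  `n ≥ 6ΔD/(1−ρ)` and `n ≥ 2(1+ρ)σ̄²/((1−ρ)ε)` suffice (`ρ < 1`, `ε > 0`).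

NOT CLAIMED: any value of `ρ`, `σ̄`, `ΔD` for a lattice kernel (informative only when
`ρe^{3ΔD/n} < 1`); the sample (Kish) ESS of a finite run.
-/

namespace Summit.Ventures.LatticeQCDFlow.Scaling

open Finset
open Literature.Probability.MarkovChains (IsRowStochastic IsStationary stepLaw DetailedBalance
  IsIrreducible lambdaStar lambdaStar_nonneg)
open Summit.Ventures.LatticeQCDFlow.Exactness
open Summit.Ventures.LatticeQCDFlow.Theory2

variable {X : Type*} [Fintype X] [Nonempty X]

/-- **`1/ÊSS = E_F[e^{−2(W − ΔF)}]`** along the uniform protocol (`ΔF = F(1) − F(0)`), for positive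
layers leaving the Boltzmann weights invariant. -/
theorem inv_essFrac_path_eq_expMoment_two (S₀ D : X → ℝ) (P : ℕ → X → X → ℝ) {n : ℕ}
    (hn : n ≠ 0) (hPpos : ∀ k x y, 0 < P k x y)
    (hst : ∀ k, IsStationary
      (fun x => Real.exp (-(linAction S₀ D (((k + 1 : ℕ) : ℝ) / n) x))) (P k)) :
    (essFrac (revPathLaw (fun k : Fin (n + 1) => linAction S₀ D ((k : ℝ) / n)) (fun k : Fin n => P k))
        (pathLaw (gibbsLaw (linAction S₀ D (((0 : Fin (n + 1)) : ℝ) / n))) (fun k : Fin n => P k)))⁻¹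
      = ∑ ω : Fin (n + 1) → X,
          pathLaw (gibbsLaw (linAction S₀ D (((0 : ℕ) : ℝ) / n))) (fun k : Fin n => P k) ω
            * Real.exp (-(2 * (work (fun k : Fin (n + 1) => linAction S₀ D ((k : ℝ) / n)) ω
                - (linFreeEnergy S₀ D 1 - linFreeEnergy S₀ D 0)))) := by
  have hn' : (0 : ℝ) < n := Nat.cast_pos.mpr (Nat.pos_of_ne_zero hn)
  set S : Fin (n + 1) → X → ℝ := fun k => linAction S₀ D ((k : ℝ) / n) with hS
  have hP' : ∀ (k : Fin n) x y, 0 < (fun k : Fin n => P k) k x y := fun k x y => hPpos k x y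
  have hst' : ∀ k : Fin n, IsStationary (fun x => Real.exp (-(S k.succ x)))
      ((fun k : Fin n => P k) k) := by
    intro k; simpa only [hS, Fin.val_succ] using hst k
  have h := inv_essFrac_path_eq_sum_exp_two S hP' hst'
  have hS0 : S 0 = linAction S₀ D (((0 : Fin (n + 1)) : ℝ) / n) := rfl
  have hSlast : freeEnergy (S (Fin.last n)) = linFreeEnergy S₀ D 1 := by
    rw [hS, linFreeEnergy]; simp only [Fin.val_last]; rw [div_self hn'.ne']
  have hS0' : freeEnergy (S 0) = linFreeEnergy S₀ D 0 := by rw [hS, linFreeEnergy]; simp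
  have hS0'' : gibbsLaw (S 0) = gibbsLaw (linAction S₀ D (((0 : ℕ) : ℝ) / n)) := by
    rw [hS]; simp
  rw [← hS0, h, hSlast, hS0', hS0'']

/-- **THE ESS FLOOR IN `2τ̄` FORM (uniform grid, arbitrary layers).**
`exp(−((1+θ₂)/(1−θ₂))·σ̄²/n) ≤ ÊSS`, `θ₂ = ρ·e^{3ΔD/n} < 1`. -/
theorem exp_le_ess_path_uniform_sharp (S₀ D : X → ℝ) (P : ℕ → X → X → ℝ) {n : ℕ} (hn : n ≠ 0)
    {ΔD ρ σbar : ℝ} (hD : ∀ x y, |D x - D y| ≤ ΔD) (hPpos : ∀ k x y, 0 < P k x y)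
    (hst : ∀ k, IsStationary
      (fun x => Real.exp (-(linAction S₀ D (((k + 1 : ℕ) : ℝ) / n) x))) (P k))
    (hProw : ∀ k x, ∑ y, P k x y = 1)
    (hK : ∀ k, ChiSqContracts (P k) (gibbsLaw (linAction S₀ D (((k + 1 : ℕ) : ℝ) / n))) ρ)
    (hρ : 0 ≤ ρ) (hσ0 : 0 ≤ σbar) (hσ : ∀ c, varD S₀ D c ≤ σbar ^ 2)
    (hθ1 : ρ * Real.exp (3 * ΔD / n) < 1) :
    Real.exp (-((1 + ρ * Real.exp (3 * ΔD / n)) / (1 - ρ * Real.exp (3 * ΔD / n))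
        * (σbar ^ 2 / n)))
      ≤ essFrac (revPathLaw (fun k : Fin (n + 1) => linAction S₀ D ((k : ℝ) / n))
            (fun k : Fin n => P k))
          (pathLaw (gibbsLaw (linAction S₀ D (((0 : Fin (n + 1)) : ℝ) / n))) (fun k : Fin n => P k)) := by
  -- the t = 2 exponential moment
  have h2 : (5 * |(2:ℝ)| + 2 * |(2:ℝ) - 1|) * ΔD / (4 * n) = 3 * ΔD / n := by
    rw [show (2:ℝ) - 1 = 1 by norm_num, abs_of_pos (by norm_num : (0:ℝ) < 2), abs_one]
    ring
  have hθ1' : ρ * Real.exp ((5 * |(2:ℝ)| + 2 * |(2:ℝ) - 1|) * ΔD / (4 * n)) < 1 := by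
    rwa [h2]
  have hmgf := expMoment_work_uniform_le 2 S₀ D P hn hD hPpos hProw hK hρ hσ0 hσ hθ1'
  rw [h2, show (2:ℝ) * (2 - 1) = 2 by norm_num, abs_of_pos (by norm_num : (0:ℝ) < 2),
    max_eq_left (by norm_num : (0:ℝ) ≤ 2)] at hmgf
  rw [← inv_essFrac_path_eq_expMoment_two S₀ D P hn hPpos hst] at hmgf
  have hE0 : 0 < essFrac (revPathLaw (fun k : Fin (n + 1) => linAction S₀ D ((k : ℝ) / n))
      (fun k : Fin n => P k))
      (pathLaw (gibbsLaw (linAction S₀ D (((0 : Fin (n + 1)) : ℝ) / n))) (fun k : Fin n => P k)) := by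
    have hst' : ∀ k : Fin n, IsStationary
        (fun x => Real.exp (-((fun k : Fin (n + 1) => linAction S₀ D ((k : ℝ) / n)) k.succ x)))
        ((fun k : Fin n => P k) k) := by
      intro k; simpa only [Fin.val_succ] using hst k
    exact essFrac_pos (pathLaw_pos (gibbsLaw_pos _) fun k x y => hPpos k x y)
      (sum_revPathLaw _ _ hst')
  -- 1/E ≤ exp(B) ⇒ exp(-B) ≤ E
  rw [Real.exp_neg, inv_le_comm₀ (Real.exp_pos _) hE0]
  refine hmgf.trans (le_of_eq ?_)
  congr 1
  have h1θ : 1 - ρ * Real.exp (3 * ΔD / n) ≠ 0 := ne_of_gt (by linarith)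
  field_simp
  ring

/-- **Reversible irreducible positive layers**: the `2τ̄`-form floor with `ρ = max_k λ⋆(P_k)`. -/
theorem exp_le_ess_path_uniform_sharp_of_reversible [DecidableEq X] (S₀ D : X → ℝ)
    (P : ℕ → X → X → ℝ) {n : ℕ} (hn : n ≠ 0) {ΔD ρ σbar : ℝ} (hD : ∀ x y, |D x - D y| ≤ ΔD)
    (hP : ∀ k, IsRowStochastic (P k)) (hPpos : ∀ k x y, 0 < P k x y)
    (hDB : ∀ k, DetailedBalance (gibbsLaw (linAction S₀ D (((k + 1 : ℕ) : ℝ) / n))) (P k))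
    (hirr : ∀ k, IsIrreducible (P k)) (hlam : ∀ k, lambdaStar (P k) ≤ ρ)
    (hσ0 : 0 ≤ σbar) (hσ : ∀ c, varD S₀ D c ≤ σbar ^ 2)
    (hθ1 : ρ * Real.exp (3 * ΔD / n) < 1) :
    Real.exp (-((1 + ρ * Real.exp (3 * ΔD / n)) / (1 - ρ * Real.exp (3 * ΔD / n))
        * (σbar ^ 2 / n)))
      ≤ essFrac (revPathLaw (fun k : Fin (n + 1) => linAction S₀ D ((k : ℝ) / n))
            (fun k : Fin n => P k))
          (pathLaw (gibbsLaw (linAction S₀ D (((0 : Fin (n + 1)) : ℝ) / n))) (fun k : Fin n => P k)) := by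
  have hρ : 0 ≤ ρ := (lambdaStar_nonneg (P 0)).trans (hlam 0)
  refine exp_le_ess_path_uniform_sharp S₀ D P hn hD hPpos
    (fun k => isStationary_exp_of_detailedBalance_gibbsLaw (hDB k) (hP k).2)
    (fun k => (hP k).2) (fun k => ?_) hρ hσ0 hσ hθ1
  exact (chiSqContracts_of_reversible (gibbsLaw_pos _) (sum_gibbsLaw _) (hP k) (hDB k)
    (hirr k)).mono (fun x => (gibbsLaw_pos _ x).le) (lambdaStar_nonneg _) (hlam k)

/-- **ACCEPTANCE FLOOR (NCMC / flow-Metropolis on path space).**  Under the hypotheses of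
`exp_le_ess_path_uniform_sharp`, the stationary Metropolis acceptance of the forward path proposal
against the reverse path target satisfies `(8/9)·exp(−((1+θ₂)/(1−θ₂))·σ̄²/n) ≤ accRate`
(theory-2's `accRate ≥ (8/9)·ESS`). -/
theorem accRate_path_uniform_ge (S₀ D : X → ℝ) (P : ℕ → X → X → ℝ) {n : ℕ} (hn : n ≠ 0)
    {ΔD ρ σbar : ℝ} (hD : ∀ x y, |D x - D y| ≤ ΔD) (hPpos : ∀ k x y, 0 < P k x y)
    (hst : ∀ k, IsStationary
      (fun x => Real.exp (-(linAction S₀ D (((k + 1 : ℕ) : ℝ) / n) x))) (P k))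
    (hProw : ∀ k x, ∑ y, P k x y = 1)
    (hK : ∀ k, ChiSqContracts (P k) (gibbsLaw (linAction S₀ D (((k + 1 : ℕ) : ℝ) / n))) ρ)
    (hρ : 0 ≤ ρ) (hσ0 : 0 ≤ σbar) (hσ : ∀ c, varD S₀ D c ≤ σbar ^ 2)
    (hθ1 : ρ * Real.exp (3 * ΔD / n) < 1) :
    8 / 9 * Real.exp (-((1 + ρ * Real.exp (3 * ΔD / n)) / (1 - ρ * Real.exp (3 * ΔD / n))
        * (σbar ^ 2 / n)))
      ≤ accRate (revPathLaw (fun k : Fin (n + 1) => linAction S₀ D ((k : ℝ) / n))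
            (fun k : Fin n => P k))
          (pathLaw (gibbsLaw (linAction S₀ D (((0 : Fin (n + 1)) : ℝ) / n))) (fun k : Fin n => P k)) := by
  set p := revPathLaw (fun k : Fin (n + 1) => linAction S₀ D ((k : ℝ) / n)) (fun k : Fin n => P k)
    with hp
  set q := pathLaw (gibbsLaw (linAction S₀ D (((0 : Fin (n + 1)) : ℝ) / n))) (fun k : Fin n => P k)
    with hq
  have hst' : ∀ k : Fin n, IsStationary
      (fun x => Real.exp (-((fun k : Fin (n + 1) => linAction S₀ D ((k : ℝ) / n)) k.succ x)))
      ((fun k : Fin n => P k) k) := by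
    intro k; simpa only [Fin.val_succ] using hst k
  have hP' : ∀ (k : Fin n) x y, 0 < (fun k : Fin n => P k) k x y := fun k x y => hPpos k x y
  have hp0 : ∀ ω, 0 ≤ p ω := fun ω =>
    (revPathLaw_pos (fun k : Fin (n + 1) => linAction S₀ D ((k : ℝ) / n)) hP' ω).le
  have hq0 : ∀ ω, 0 < q ω := fun ω => pathLaw_pos (gibbsLaw_pos _) hP' ω
  have hp1 : ∑ ω, p ω = 1 := sum_revPathLaw _ _ hst'
  have hq1 : ∑ ω, q ω = 1 := by
    rw [hq, sum_pathLaw _ _ (fun k x => hProw k x), sum_gibbsLaw]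
  have hE := exp_le_ess_path_uniform_sharp S₀ D P hn hD hPpos hst hProw hK hρ hσ0 hσ hθ1
  have hE0 : 0 < essFrac p q := essFrac_pos hq0 hp1
  have h89 := accRate_mul_inv_essFrac_ge hp0 hq0 hp1 hq1
  have h : 8 / 9 * essFrac p q ≤ accRate p q := by
    have := mul_le_mul_of_nonneg_right h89 hE0.le
    rwa [mul_assoc, inv_mul_cancel₀ hE0.ne', mul_one] at this
  exact (mul_le_mul_of_nonneg_left hE (by norm_num)).trans h

/-- **`exp`-free form of the floor.**  With `u = 3ΔD/n` and `u + ρ < 1`: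
`exp(−((1 − u + ρ)/(1 − u − ρ))·σ̄²/n) ≤ ÊSS` — the constant tends to `(1+ρ)/(1−ρ) = 2τ̄(ρ)`. -/
theorem exp_le_ess_path_uniform_rational (S₀ D : X → ℝ) (P : ℕ → X → X → ℝ) {n : ℕ} (hn : n ≠ 0)
    {ΔD ρ σbar : ℝ} (hD : ∀ x y, |D x - D y| ≤ ΔD) (hPpos : ∀ k x y, 0 < P k x y)
    (hst : ∀ k, IsStationary
      (fun x => Real.exp (-(linAction S₀ D (((k + 1 : ℕ) : ℝ) / n) x))) (P k))
    (hProw : ∀ k x, ∑ y, P k x y = 1)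
    (hK : ∀ k, ChiSqContracts (P k) (gibbsLaw (linAction S₀ D (((k + 1 : ℕ) : ℝ) / n))) ρ)
    (hρ : 0 ≤ ρ) (hσ0 : 0 ≤ σbar) (hσ : ∀ c, varD S₀ D c ≤ σbar ^ 2)
    (hu : 3 * ΔD / n + ρ < 1) :
    Real.exp (-((1 - 3 * ΔD / n + ρ) / (1 - 3 * ΔD / n - ρ) * (σbar ^ 2 / n)))
      ≤ essFrac (revPathLaw (fun k : Fin (n + 1) => linAction S₀ D ((k : ℝ) / n))
            (fun k : Fin n => P k))
          (pathLaw (gibbsLaw (linAction S₀ D (((0 : Fin (n + 1)) : ℝ) / n))) (fun k : Fin n => P k)) := by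
  set u := 3 * ΔD / n with hu'
  have hΔ : 0 ≤ ΔD := (abs_nonneg _).trans (hD (Classical.arbitrary X) (Classical.arbitrary X))
  have hu0 : 0 ≤ u := by rw [hu']; positivity
  have hu1 : u < 1 := by linarith
  have hexp : Real.exp u ≤ 1 / (1 - u) := Real.exp_bound_div_one_sub_of_interval hu0 hu1
  have h1u : 0 < 1 - u := by linarith
  -- θ₂ ≤ ρ/(1−u) < 1
  have hθle : ρ * Real.exp u ≤ ρ / (1 - u) := by
    have := mul_le_mul_of_nonneg_left hexp hρ
    rwa [mul_one_div] at this
  have hθ1 : ρ * Real.exp (3 * ΔD / n) < 1 := by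
    rw [← hu']
    refine lt_of_le_of_lt hθle ?_
    rw [div_lt_one h1u]; linarith
  have hfloor := exp_le_ess_path_uniform_sharp S₀ D P hn hD hPpos hst hProw hK hρ hσ0 hσ hθ1
  refine le_trans (Real.exp_le_exp.mpr ?_) hfloor
  rw [← hu']
  -- −A·s ≤ −B·s with B ≤ A, s ≥ 0
  have hs : 0 ≤ σbar ^ 2 / n := by positivity
  have hθ0 : 0 ≤ ρ * Real.exp u := by positivity
  have hθ1' : ρ * Real.exp u < 1 := by rw [hu']; exact hθ1
  have hmono : (1 + ρ * Real.exp u) / (1 - ρ * Real.exp u) ≤ (1 - u + ρ) / (1 - u - ρ) := by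
    have hden1 : 0 < 1 - ρ * Real.exp u := by linarith
    have hden2 : 0 < 1 - u - ρ := by linarith
    rw [div_le_div_iff₀ hden1 hden2]
    -- (1+θ)(1−u−ρ) ≤ (1−u+ρ)(1−θ)  ⟸  θ(1−u) ≤ ρ
    have hθρ : ρ * Real.exp u * (1 - u) ≤ ρ := by
      have := mul_le_mul_of_nonneg_right hθle h1u.le
      rwa [div_mul_cancel₀ ρ h1u.ne'] at this
    nlinarith [hθρ, hθ0, h1u]
  nlinarith [mul_le_mul_of_nonneg_right hmono hs]

/-- **Steps for `ÊSS ≥ 1 − ε` with arbitrary `χ²`-contracting layers.**  If `ρ < 1`, `ε > 0`,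
`n ≥ 6ΔD/(1−ρ)` and `n ≥ 2(1+ρ)σ̄²/((1−ρ)ε)`, then `1 − ε ≤ ÊSS` (from the `exp`-free floor:
`u = 3ΔD/n ≤ (1−ρ)/2`, so the constant is `≤ 2(1+ρ)/(1−ρ)`, and `e^{−y} ≥ 1 − y`). -/
theorem ess_ge_one_sub_of_steps (S₀ D : X → ℝ) (P : ℕ → X → X → ℝ) {n : ℕ} (hn : n ≠ 0)
    {ΔD ρ σbar ε : ℝ} (hD : ∀ x y, |D x - D y| ≤ ΔD) (hPpos : ∀ k x y, 0 < P k x y)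
    (hst : ∀ k, IsStationary
      (fun x => Real.exp (-(linAction S₀ D (((k + 1 : ℕ) : ℝ) / n) x))) (P k))
    (hProw : ∀ k x, ∑ y, P k x y = 1)
    (hK : ∀ k, ChiSqContracts (P k) (gibbsLaw (linAction S₀ D (((k + 1 : ℕ) : ℝ) / n))) ρ)
    (hρ : 0 ≤ ρ) (hρ1 : ρ < 1) (hσ0 : 0 ≤ σbar) (hσ : ∀ c, varD S₀ D c ≤ σbar ^ 2)
    (hε : 0 < ε) (hn1 : 6 * ΔD / (1 - ρ) ≤ n) (hn2 : 2 * (1 + ρ) * σbar ^ 2 / ((1 - ρ) * ε) ≤ n) :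
    1 - ε ≤ essFrac (revPathLaw (fun k : Fin (n + 1) => linAction S₀ D ((k : ℝ) / n))
            (fun k : Fin n => P k))
          (pathLaw (gibbsLaw (linAction S₀ D (((0 : Fin (n + 1)) : ℝ) / n))) (fun k : Fin n => P k)) := by
  have hn' : (0 : ℝ) < n := Nat.cast_pos.mpr (Nat.pos_of_ne_zero hn)
  have hΔ : 0 ≤ ΔD := (abs_nonneg _).trans (hD (Classical.arbitrary X) (Classical.arbitrary X))
  have h1ρ : 0 < 1 - ρ := by linarith
  -- u = 3ΔD/n ≤ (1−ρ)/2
  have hu : 3 * ΔD / n ≤ (1 - ρ) / 2 := by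
    rw [div_le_iff₀ hn']
    have := (div_le_iff₀ h1ρ).mp hn1
    nlinarith
  have hu0 : 0 ≤ 3 * ΔD / n := by positivity
  have huρ : 3 * ΔD / n + ρ < 1 := by linarith
  have hfloor := exp_le_ess_path_uniform_rational S₀ D P hn hD hPpos hst hProw hK hρ hσ0 hσ huρ
  refine le_trans ?_ hfloor
  -- the constant is at most 2(1+ρ)/(1−ρ), and the exponent at most ε
  set y := (1 - 3 * ΔD / n + ρ) / (1 - 3 * ΔD / n - ρ) * (σbar ^ 2 / n) with hy
  have hden : (1 - ρ) / 2 ≤ 1 - 3 * ΔD / n - ρ := by linarith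
  have hden0 : 0 < 1 - 3 * ΔD / n - ρ := by linarith
  have hconst : (1 - 3 * ΔD / n + ρ) / (1 - 3 * ΔD / n - ρ) ≤ 2 * (1 + ρ) / (1 - ρ) := by
    rw [div_le_div_iff₀ hden0 h1ρ]
    nlinarith [hu0, hρ]
  have hσn : 0 ≤ σbar ^ 2 / n := by positivity
  have hy_le : y ≤ ε := by
    have h1 : y ≤ 2 * (1 + ρ) / (1 - ρ) * (σbar ^ 2 / n) :=
      mul_le_mul_of_nonneg_right hconst hσn
    have h2 : 2 * (1 + ρ) / (1 - ρ) * (σbar ^ 2 / n) ≤ ε := by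
      rw [show 2 * (1 + ρ) / (1 - ρ) * (σbar ^ 2 / n) = 2 * (1 + ρ) * σbar ^ 2 / ((1 - ρ) * n) by
        field_simp]
      rw [div_le_iff₀ (mul_pos h1ρ hn')]
      have := (div_le_iff₀ (mul_pos h1ρ hε)).mp hn2
      nlinarith
    exact h1.trans h2
  -- 1 − ε ≤ 1 − y ≤ e^{−y}
  calc 1 - ε ≤ 1 - y := by linarith
    _ ≤ Real.exp (-y) := by linarith [Real.add_one_le_exp (-y)]

end Summit.Ventures.LatticeQCDFlow.Scaling
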